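/-
Copyright: the b2b-balaban T⁴-continuum CRUX team, row NE7b OWNER lineage `t4-ne7b-p1` (gen 148). Project licence.
-/
import Summits.QuantumFields.BalabanUV.T4Continuum.Spine.NE7b.SupWeightedKernelLetterTransportFive

/-!
# THE WEIGHTED TRANSPORT AT ORDER FIVE IN THE OTHER FOUR ROLES ((771) continued, pattern (774); file (775)).  (771) transported the
# first-index full-graph letter of a nonnegative order-5 majorant `K5` through `t • J_β` (coarse majorant `K5′ = |t|⁵·Σ_{fibres}K5`,
# `ϑc(βx,βx′) ≤ M·ϑ(x,x′)` ⟹ coarse letter `≤ |t|⁵·n·M¹⁰·κ`); the weighted class carries the order-5 letter in FIVE roles (slot shapes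
# `k5ϑ1 … k5ϑ5` of (756)–(760): the fixed index is the first ∕ second ∕ third ∕ fourth ∕ fifth argument of `K5 y z t s x`).  THIS FILE derives
# the second-, third-, fourth- and fifth-index transports from (771) applied to the kernel with permuted arguments: the fibre sums inside the
# coarse majorant commute (`Finset.sum_comm`), the weights (fine and coarse) are symmetric, so both sides agree up to the commutative-monoid
# normal form of the ten-factor weight products; the fifth-index role needs in addition a cyclic reorder of the four free sums on both
# scales (row NE7b, node U5c; (771) BY NAME; Mathlib; [folklore] finite sums).

Cell `pub-balaban`, sub-cell `t4`, spine estimate NE7b (`T4WeightBudget.RelWeightBound`; the cell's OWN estimate — NOT PRINTED in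
[Bałaban 1983–89], NOT PROVED).  Crux-route work under `Spine/NE7b/` by the row OWNER (`t4-ne7b-p1` gen 148, file (775)) under FREEZE
(0)'s crux-prover clause; NOTHING of Bałaban's is named as a Lean object, valued or asserted; no `T4Continuum/Support` leaf typed; no
`def`, no notation; zero `sorry`.  Imports (BY NAME): (771) `…SupWeightedKernelLetterTransportFive`.

WHAT IS PROVED ([folklore]): **`weighted_coarse_k5_letter_le_second`** (slot `z`, letter `k5ϑ2`), **`weighted_coarse_k5_letter_le_third`**
(slot `t`, letter `k5ϑ3`), **`weighted_coarse_k5_letter_le_fourth`** (slot `s`, letter `k5ϑ4`), **`weighted_coarse_k5_letter_le_fifth`** (slot `x`,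
letter `k5ϑ5`): in each role, fibres of `≤ n` sites, the fine full-graph letter `≤ κ` in that role's slot shape and `ϑc(βx,βx′) ≤ M·ϑ(x,x′)` give
the coarse letter of `K5′` in the SAME slot shape one scale up, `≤ |t|⁵·n·M¹⁰·κ`.  With (766)∕(768) (orders 2, 3), (770)∕(774) (order 4) and
(771) the weighted transport is typed in EVERY role at EVERY order 2–5; toy.

HONEST (what this is NOT).  Finite-sum bookkeeping (the one-step compositions in these roles and the flow of the letter values not typed
here); scalar skeleton ((A3), NC-NE7b-α UNRULED); nothing of Bałaban's asserted.  BY-NAME EFFECT ON THE WALL: NONE.  NE7b NOT PRINTED ∕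
NOT PROVED; spine PROVED 0∕9; rung (B)+1 — the programme's measures remain FINITE-torus statements; NOT the mass gap, NOT Clay.  HONEST
DEPENDENCY: continuum YM on T⁴ ⇐ BetaPertH ∧ nine spine estimates (0∕9 proved); BetaPertH ⇐ (D1) ∧ (D4) ∧ CAP+tail; G-an2-4 gates
asym, D1 and NE2∕3∕4.
-/

set_option autoImplicit false

noncomputable section

namespace Summit.QuantumFields.BalabanUV.T4Continuum.NE7b.SupWeightedKernelLetterTransportFiveRoles

open Finset
open scoped BigOperators
open SupWeightedKernelLetterTransportFive (weighted_coarse_k5_letter_le)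

variable {ι ι' : Type} [Fintype ι] [Fintype ι'] [DecidableEq ι']

/-! ## The four remaining roles at order 5 -/

/-- **ORDER 5, SECOND INDEX FIXED** (slot shape of `k5ϑ2`): from the first-index transport (771) applied to the kernel with permuted
arguments (`fun a b c d e => K5 b a c d e`); the fibre sums inside the coarse majorant commute and the weights are symmetric. [folklore] -/
theorem weighted_coarse_k5_letter_le_second (β : ι → ι') {n : ℕ} (hfib : ∀ y, (univ.filter fun x => β x = y).card ≤ n)
    (K5 : ι → ι → ι → ι → ι → ℝ) (hK : ∀ a b c d e, 0 ≤ K5 a b c d e) {ϑ : ι → ι → ℝ} {ϑc : ι' → ι' → ℝ} {M κ : ℝ} (hM : 0 ≤ M)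
    (hϑ0 : ∀ x x', 0 ≤ ϑ x x') (hϑsymm : ∀ x x', ϑ x x' = ϑ x' x) (hϑc0 : ∀ y y', 0 ≤ ϑc y y') (hϑcsymm : ∀ y y', ϑc y y' = ϑc y' y)
    (hϑ : ∀ x x', ϑc (β x) (β x') ≤ M * ϑ x x') (hκ : 0 ≤ κ)
    (hk : ∀ z, ∑ x, ∑ y, ∑ tt, ∑ s, K5 y z tt s x *
      (ϑ x y * ϑ x z * ϑ x tt * ϑ x s * ϑ y z * ϑ y tt * ϑ y s * ϑ z tt * ϑ z s * ϑ tt s) ≤ κ) (t : ℝ) (y₁ : ι') :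
    ∑ X, ∑ Y, ∑ T, ∑ S,
        (|t| ^ 5 * ∑ y ∈ Finset.univ.filter (fun y => β y = Y), ∑ z ∈ Finset.univ.filter (fun z => β z = y₁),
          ∑ tt ∈ Finset.univ.filter (fun tt => β tt = T), ∑ s ∈ Finset.univ.filter (fun s => β s = S),
            ∑ x ∈ Finset.univ.filter (fun x => β x = X), K5 y z tt s x) *
        (ϑc X Y * ϑc X y₁ * ϑc X T * ϑc X S * ϑc Y y₁ * ϑc Y T * ϑc Y S * ϑc y₁ T * ϑc y₁ S * ϑc T S) ≤ |t| ^ 5 * n * M ^ 10 * κ := by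
  have hk2 : ∀ z, ∑ x, ∑ y, ∑ tt, ∑ s, K5 y z tt s x *
      (ϑ x z * ϑ x y * ϑ x tt * ϑ x s * ϑ z y * ϑ z tt * ϑ z s * ϑ y tt * ϑ y s * ϑ tt s) ≤ κ := fun i => by
    simpa only [hϑsymm, mul_comm, mul_left_comm, mul_assoc] using hk i
  have h := weighted_coarse_k5_letter_le β hfib (fun a b c d e => K5 b a c d e) (fun a b c d e => hK b a c d e) hM hϑ0 hϑc0 hϑ hκ hk2 t y₁
  simp only [hϑcsymm, mul_comm, mul_left_comm, mul_assoc] at h ⊢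
  simpa only [Finset.sum_comm (s := Finset.univ.filter (fun _ => β _ = y₁))] using h

/-- **ORDER 5, THIRD INDEX FIXED** (slot shape of `k5ϑ3`): from the first-index transport (771) applied to the kernel with permuted
arguments (`fun a b c d e => K5 b c a d e`); the fibre sums inside the coarse majorant commute and the weights are symmetric. [folklore] -/
theorem weighted_coarse_k5_letter_le_third (β : ι → ι') {n : ℕ} (hfib : ∀ y, (univ.filter fun x => β x = y).card ≤ n)
    (K5 : ι → ι → ι → ι → ι → ℝ) (hK : ∀ a b c d e, 0 ≤ K5 a b c d e) {ϑ : ι → ι → ℝ} {ϑc : ι' → ι' → ℝ} {M κ : ℝ} (hM : 0 ≤ M)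
    (hϑ0 : ∀ x x', 0 ≤ ϑ x x') (hϑsymm : ∀ x x', ϑ x x' = ϑ x' x) (hϑc0 : ∀ y y', 0 ≤ ϑc y y') (hϑcsymm : ∀ y y', ϑc y y' = ϑc y' y)
    (hϑ : ∀ x x', ϑc (β x) (β x') ≤ M * ϑ x x') (hκ : 0 ≤ κ)
    (hk : ∀ tt, ∑ x, ∑ y, ∑ z, ∑ s, K5 y z tt s x *
      (ϑ x y * ϑ x z * ϑ x tt * ϑ x s * ϑ y z * ϑ y tt * ϑ y s * ϑ z tt * ϑ z s * ϑ tt s) ≤ κ) (t : ℝ) (y₁ : ι') :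
    ∑ X, ∑ Y, ∑ Z, ∑ S,
        (|t| ^ 5 * ∑ y ∈ Finset.univ.filter (fun y => β y = Y), ∑ z ∈ Finset.univ.filter (fun z => β z = Z),
          ∑ tt ∈ Finset.univ.filter (fun tt => β tt = y₁), ∑ s ∈ Finset.univ.filter (fun s => β s = S),
            ∑ x ∈ Finset.univ.filter (fun x => β x = X), K5 y z tt s x) *
        (ϑc X Y * ϑc X Z * ϑc X y₁ * ϑc X S * ϑc Y Z * ϑc Y y₁ * ϑc Y S * ϑc Z y₁ * ϑc Z S * ϑc y₁ S) ≤ |t| ^ 5 * n * M ^ 10 * κ := by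
  have hk2 : ∀ tt, ∑ x, ∑ y, ∑ z, ∑ s, K5 y z tt s x *
      (ϑ x tt * ϑ x y * ϑ x z * ϑ x s * ϑ tt y * ϑ tt z * ϑ tt s * ϑ y z * ϑ y s * ϑ z s) ≤ κ := fun i => by
    simpa only [hϑsymm, mul_comm, mul_left_comm, mul_assoc] using hk i
  have h := weighted_coarse_k5_letter_le β hfib (fun a b c d e => K5 b c a d e) (fun a b c d e => hK b c a d e) hM hϑ0 hϑc0 hϑ hκ hk2 t y₁
  simp only [hϑcsymm, mul_comm, mul_left_comm, mul_assoc] at h ⊢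
  simpa only [Finset.sum_comm (s := Finset.univ.filter (fun _ => β _ = y₁))] using h

/-- **ORDER 5, FOURTH INDEX FIXED** (slot shape of `k5ϑ4`): from the first-index transport (771) applied to the kernel with permuted
arguments (`fun a b c d e => K5 b c d a e`); the fibre sums inside the coarse majorant commute and the weights are symmetric. [folklore] -/
theorem weighted_coarse_k5_letter_le_fourth (β : ι → ι') {n : ℕ} (hfib : ∀ y, (univ.filter fun x => β x = y).card ≤ n)
    (K5 : ι → ι → ι → ι → ι → ℝ) (hK : ∀ a b c d e, 0 ≤ K5 a b c d e) {ϑ : ι → ι → ℝ} {ϑc : ι' → ι' → ℝ} {M κ : ℝ} (hM : 0 ≤ M)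
    (hϑ0 : ∀ x x', 0 ≤ ϑ x x') (hϑsymm : ∀ x x', ϑ x x' = ϑ x' x) (hϑc0 : ∀ y y', 0 ≤ ϑc y y') (hϑcsymm : ∀ y y', ϑc y y' = ϑc y' y)
    (hϑ : ∀ x x', ϑc (β x) (β x') ≤ M * ϑ x x') (hκ : 0 ≤ κ)
    (hk : ∀ s, ∑ x, ∑ y, ∑ z, ∑ tt, K5 y z tt s x *
      (ϑ x y * ϑ x z * ϑ x tt * ϑ x s * ϑ y z * ϑ y tt * ϑ y s * ϑ z tt * ϑ z s * ϑ tt s) ≤ κ) (t : ℝ) (y₁ : ι') :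
    ∑ X, ∑ Y, ∑ Z, ∑ T,
        (|t| ^ 5 * ∑ y ∈ Finset.univ.filter (fun y => β y = Y), ∑ z ∈ Finset.univ.filter (fun z => β z = Z),
          ∑ tt ∈ Finset.univ.filter (fun tt => β tt = T), ∑ s ∈ Finset.univ.filter (fun s => β s = y₁),
            ∑ x ∈ Finset.univ.filter (fun x => β x = X), K5 y z tt s x) *
        (ϑc X Y * ϑc X Z * ϑc X T * ϑc X y₁ * ϑc Y Z * ϑc Y T * ϑc Y y₁ * ϑc Z T * ϑc Z y₁ * ϑc T y₁) ≤ |t| ^ 5 * n * M ^ 10 * κ := by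
  have hk2 : ∀ s, ∑ x, ∑ y, ∑ z, ∑ tt, K5 y z tt s x *
      (ϑ x s * ϑ x y * ϑ x z * ϑ x tt * ϑ s y * ϑ s z * ϑ s tt * ϑ y z * ϑ y tt * ϑ z tt) ≤ κ := fun i => by
    simpa only [hϑsymm, mul_comm, mul_left_comm, mul_assoc] using hk i
  have h := weighted_coarse_k5_letter_le β hfib (fun a b c d e => K5 b c d a e) (fun a b c d e => hK b c d a e) hM hϑ0 hϑc0 hϑ hκ hk2 t y₁
  simp only [hϑcsymm, mul_comm, mul_left_comm, mul_assoc] at h ⊢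
  simpa only [Finset.sum_comm (s := Finset.univ.filter (fun _ => β _ = y₁))] using h

/-- **ORDER 5, FIFTH INDEX FIXED** (slot shape of `k5ϑ5`): from the first-index transport (771) applied to the kernel with permuted
arguments (`fun a b c d e => K5 b c d e a`); here, besides the commuting fibre sums and the symmetric weights, the four free sums are
reordered cyclically on both scales (`Finset.sum_comm` three times). [folklore] -/
theorem weighted_coarse_k5_letter_le_fifth (β : ι → ι') {n : ℕ} (hfib : ∀ y, (univ.filter fun x => β x = y).card ≤ n)
    (K5 : ι → ι → ι → ι → ι → ℝ) (hK : ∀ a b c d e, 0 ≤ K5 a b c d e) {ϑ : ι → ι → ℝ} {ϑc : ι' → ι' → ℝ} {M κ : ℝ} (hM : 0 ≤ M)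
    (hϑ0 : ∀ x x', 0 ≤ ϑ x x') (hϑsymm : ∀ x x', ϑ x x' = ϑ x' x) (hϑc0 : ∀ y y', 0 ≤ ϑc y y') (hϑcsymm : ∀ y y', ϑc y y' = ϑc y' y)
    (hϑ : ∀ x x', ϑc (β x) (β x') ≤ M * ϑ x x') (hκ : 0 ≤ κ)
    (hk : ∀ x, ∑ y, ∑ z, ∑ tt, ∑ s, K5 y z tt s x *
      (ϑ x y * ϑ x z * ϑ x tt * ϑ x s * ϑ y z * ϑ y tt * ϑ y s * ϑ z tt * ϑ z s * ϑ tt s) ≤ κ) (t : ℝ) (y₁ : ι') :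
    ∑ Y, ∑ Z, ∑ T, ∑ S,
        (|t| ^ 5 * ∑ y ∈ Finset.univ.filter (fun y => β y = Y), ∑ z ∈ Finset.univ.filter (fun z => β z = Z),
          ∑ tt ∈ Finset.univ.filter (fun tt => β tt = T), ∑ s ∈ Finset.univ.filter (fun s => β s = S),
            ∑ x ∈ Finset.univ.filter (fun x => β x = y₁), K5 y z tt s x) *
        (ϑc y₁ Y * ϑc y₁ Z * ϑc y₁ T * ϑc y₁ S * ϑc Y Z * ϑc Y T * ϑc Y S * ϑc Z T * ϑc Z S * ϑc T S) ≤ |t| ^ 5 * n * M ^ 10 * κ := by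
  have hk2 : ∀ x, ∑ s, ∑ y, ∑ z, ∑ tt, K5 y z tt s x *
      (ϑ s x * ϑ s y * ϑ s z * ϑ s tt * ϑ x y * ϑ x z * ϑ x tt * ϑ y z * ϑ y tt * ϑ z tt) ≤ κ := fun i => by
    have e : (∑ s, ∑ y, ∑ z, ∑ tt, K5 y z tt s i *
          (ϑ s i * ϑ s y * ϑ s z * ϑ s tt * ϑ i y * ϑ i z * ϑ i tt * ϑ y z * ϑ y tt * ϑ z tt)) =
        ∑ y, ∑ z, ∑ tt, ∑ s, K5 y z tt s i *
          (ϑ s i * ϑ s y * ϑ s z * ϑ s tt * ϑ i y * ϑ i z * ϑ i tt * ϑ y z * ϑ y tt * ϑ z tt) :=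
      Finset.sum_comm.trans (Finset.sum_congr rfl fun _ _ =>
        Finset.sum_comm.trans (Finset.sum_congr rfl fun _ _ => Finset.sum_comm))
    rw [e]
    simpa only [hϑsymm, mul_comm, mul_left_comm, mul_assoc] using hk i
  have h := weighted_coarse_k5_letter_le β hfib (fun a b c d e => K5 b c d e a) (fun a b c d e => hK b c d e a) hM hϑ0 hϑc0 hϑ hκ hk2 t y₁
  rw
      [show (∑ Y, ∑ Z, ∑ T, ∑ S,
            (|t| ^ 5 * ∑ y ∈ Finset.univ.filter (fun y => β y = Y), ∑ z ∈ Finset.univ.filter (fun z => β z = Z),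
              ∑ tt ∈ Finset.univ.filter (fun tt => β tt = T), ∑ s ∈ Finset.univ.filter (fun s => β s = S),
                ∑ x ∈ Finset.univ.filter (fun x => β x = y₁), K5 y z tt s x) *
            (ϑc y₁ Y * ϑc y₁ Z * ϑc y₁ T * ϑc y₁ S * ϑc Y Z * ϑc Y T * ϑc Y S * ϑc Z T * ϑc Z S * ϑc T S)) =
          ∑ S, ∑ Y, ∑ Z, ∑ T,
            (|t| ^ 5 * ∑ y ∈ Finset.univ.filter (fun y => β y = Y), ∑ z ∈ Finset.univ.filter (fun z => β z = Z),
              ∑ tt ∈ Finset.univ.filter (fun tt => β tt = T), ∑ s ∈ Finset.univ.filter (fun s => β s = S),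
                ∑ x ∈ Finset.univ.filter (fun x => β x = y₁), K5 y z tt s x) *
            (ϑc y₁ Y * ϑc y₁ Z * ϑc y₁ T * ϑc y₁ S * ϑc Y Z * ϑc Y T * ϑc Y S * ϑc Z T * ϑc Z S * ϑc T S) from
        (Finset.sum_congr rfl fun _ _ =>
            (Finset.sum_congr rfl fun _ _ => Finset.sum_comm).trans Finset.sum_comm).trans Finset.sum_comm]
  simp only [hϑcsymm, mul_comm, mul_left_comm, mul_assoc] at h ⊢
  simpa only [Finset.sum_comm (s := Finset.univ.filter (fun _ => β _ = y₁))] using h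

/-! ## Toy -/

/-- Toy (the cyclic reorder of four finite sums used in the fifth role). -/
example (f : Fin 2 → Fin 2 → Fin 2 → Fin 2 → ℝ) :
    ∑ s, ∑ y, ∑ z, ∑ w, f y z w s = ∑ y, ∑ z, ∑ w, ∑ s, f y z w s :=
  Finset.sum_comm.trans (Finset.sum_congr rfl fun _ _ =>
    Finset.sum_comm.trans (Finset.sum_congr rfl fun _ _ => Finset.sum_comm))

end Summit.QuantumFields.BalabanUV.T4Continuum.NE7b.SupWeightedKernelLetterTransportFiveRoles

end
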